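import Summits.AtomisticToContinuum.Crystallization.Theorems.OverbindingBudgetBalancedCensusRecord
import Literature.MathematicalPhysics.StatisticalMechanics.BarlowStacking

/-!
# OverbindingBudget — the balanced deep census in HARMONIC NORMAL FORM, part A: the TOLERANCE SEAM (decomp-a2c lens-4, generation 41)

File A of the two-file landing of lens-4 g41's node «HarmonicNormalForm» (landing form sha256 bd0d48b0…, critic rows 616 (E) / 618 (B);
split mechanically at the §3/§4 boundary because Theorems files with proofs are ≤ 400 lines).  This file carries §1–§3 — LAYER 1, the
tolerance seam (PROVED, generic): monotonicity of the registration predicates in the tolerance, the complementary census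
`TameBalancedMidGap` («MID»), and the convex-combination seam `tameBalancedDeepScaleGap_of_fine_mid` (and its three-tolerance iterate).
Part B (`…Theorems.OverbindingBudgetHarmonicNormalForm`, same namespace) carries §4–§5 — the typed harmonic attack K / R / B / MidAll and the
cones XLVII / XLVII′ — together with the full module documentation of the node.  Every declaration keeps its fully-qualified name
`Summit.AtomisticToContinuum.Crystallization.Theorems.OverbindingBudgetHarmonicNormalForm.*`.
-/

namespace Summit.AtomisticToContinuum.Crystallization.Theorems.OverbindingBudgetHarmonicNormalForm

open Filter Metric Set Topology
open scoped BigOperators Classical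
open Literature.MathematicalPhysics.StatisticalMechanics
open Literature.Geometry.DiscreteGeometry (IsChargeFree bondGraph nearestDist nearestDist_le_dist nearestDist_nonneg le_nearestDist bondGraph_adj
  fccTwoShellPattern hcpTwoShellPattern)
open Summit.AtomisticToContinuum.Crystallization.Theses.OverbindingBudget (RobustDefectLimitWindows)
open Summit.AtomisticToContinuum.Crystallization.Theses.PricedLinkCensus (ChargedEnergyGap)
open Summit.AtomisticToContinuum.Crystallization.Theorems.OverbindingBudgetGradedBareness (CleanlessExcessT)
open Summit.AtomisticToContinuum.Crystallization.Theorems.OverbindingBudgetCoherentCut (CoherentResidual)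
open Summit.AtomisticToContinuum.Crystallization.Theorems.OverbindingBudgetMisfitCensusStatements (Bad Short Long)
open Summit.AtomisticToContinuum.Crystallization.Theorems.OverbindingBudgetMisfitRegistration (Framed Reg DeepReg regScaleCount)
open Summit.AtomisticToContinuum.Crystallization.Theorems.OverbindingBudgetTwoShellShape (TwoShellShape)
open Summit.AtomisticToContinuum.Crystallization.Theorems.OverbindingBudgetMisfitWindowStatements (InWindow offCount)
open Summit.AtomisticToContinuum.Crystallization.Theorems.OverbindingBudgetBalancedCensusStatements
open Summit.AtomisticToContinuum.Crystallization.Theorems.OverbindingBudgetBalancedCensusRecord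

variable {N : ℕ}

/-! ## §1  Finer tolerance is weaker: monotonicity of the registration predicates in `ε` (PROVED) -/

/-- `Framed` is monotone in the tolerance. [this file] -/
theorem framed_mono_tol {ε₁ ε g : ℝ} (h : ε₁ ≤ ε) {y : Fin N → EuclideanSpace ℝ (Fin 3)} {i : Fin N}
    (hF : Framed ε₁ g y i) : Framed ε g y i := by
  obtain ⟨A, P, f, hP, hf, hinj, hcov⟩ := hF
  exact ⟨A, P, f, hP, fun v hv => ⟨(hf v hv).1, (hf v hv).2.trans (mul_le_mul_of_nonneg_right h (nearestDist_nonneg y i))⟩,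
    hinj, hcov⟩

/-- `Reg` is monotone in the tolerance. [this file] -/
theorem reg_mono_tol {ε₁ ε g : ℝ} (h : ε₁ ≤ ε) {y : Fin N → EuclideanSpace ℝ (Fin 3)} {i : Fin N} (hR : Reg ε₁ g y i) :
    Reg ε g y i :=
  ⟨hR.1, framed_mono_tol h hR.2⟩

/-- `DeepReg` is monotone in the tolerance. [this file] -/
theorem deepReg_mono_tol {ρ ε₁ ε g : ℝ} (h : ε₁ ≤ ε) {y : Fin N → EuclideanSpace ℝ (Fin 3)} {i : Fin N}
    (hD : DeepReg ρ ε₁ g y i) : DeepReg ρ ε g y i :=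
  fun i' hi' => reg_mono_tol h (hD i' hi')

/-- The deep registered scale-bad count is monotone in the tolerance. [this file] -/
theorem regScaleCount_mono_tol {a s ρ ε₁ ε g : ℝ} (h : ε₁ ≤ ε) (y : Fin N → EuclideanSpace ℝ (Fin 3)) :
    regScaleCount a s ρ ε₁ g y ≤ regScaleCount a s ρ ε g y := by
  simp only [regScaleCount, Nat.card_eq_fintype_card, Fintype.card_subtype]
  apply Finset.card_le_card
  intro i hi
  rw [Finset.mem_filter] at hi ⊢
  exact ⟨hi.1, hi.2.1, deepReg_mono_tol h hi.2.2⟩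

/-- The not-deep count is antitone in the tolerance. [this file] -/
theorem notDeepCount_anti_tol {ρ ε₁ ε g : ℝ} (h : ε₁ ≤ ε) (y : Fin N → EuclideanSpace ℝ (Fin 3)) :
    notDeepCount ρ ε g y ≤ notDeepCount ρ ε₁ g y := by
  simp only [notDeepCount, Nat.card_eq_fintype_card, Fintype.card_subtype]
  apply Finset.card_le_card
  intro i hi
  rw [Finset.mem_filter] at hi ⊢
  exact ⟨hi.1, fun hD => hi.2 (deepReg_mono_tol h hD)⟩

/-- **`BalancedDeepScaleGapW` is antitone in the tolerance**: `ε₁ ≤ ε` ⇒ BDSG_W(ε) ⇒ BDSG_W(ε₁) (fewer priced, more rebated). [this file] -/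
theorem balancedDeepScaleGapW_anti_tol {a s ρ ε₁ ε g σ₁ σ₂ : ℝ} (hε : ε₁ ≤ ε) (h : BalancedDeepScaleGapW a s ρ ε g σ₁ σ₂) :
    BalancedDeepScaleGapW a s ρ ε₁ g σ₁ σ₂ := by
  obtain ⟨c, C, hc, h⟩ := h
  refine ⟨c, max C 0, hc, fun N y hy => ?_⟩
  obtain ⟨u, hu, e⟩ := h N y hy
  refine ⟨u, hu, ?_⟩
  have hC : C ≤ max C 0 := le_max_left _ _
  have hC0 : 0 ≤ max C 0 := le_max_right _ _
  have h1 : (0 : ℝ) ≤ notDeepCount ρ ε g y := Nat.cast_nonneg _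
  have h1' : (notDeepCount ρ ε g y : ℝ) ≤ notDeepCount ρ ε₁ g y := by exact_mod_cast notDeepCount_anti_tol hε y
  have h0' : (regScaleCount a s ρ ε₁ g y : ℝ) ≤ regScaleCount a s ρ ε g y := by exact_mod_cast regScaleCount_mono_tol hε y
  have h2 : (0 : ℝ) ≤ offCount σ₁ σ₂ y := Nat.cast_nonneg _
  have h3 : (0 : ℝ) ≤ (N : ℝ) ^ (2 / 3 : ℝ) := Real.rpow_nonneg (Nat.cast_nonneg _) _
  have h4 : 0 ≤ dilGain y + shGain u y := add_nonneg (dilGain_nonneg y) (shGain_nonneg _ y)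
  nlinarith [mul_le_mul_of_nonneg_right hC h1, mul_le_mul_of_nonneg_left h1' hC0, mul_le_mul_of_nonneg_left h0' hc.le,
    mul_le_mul_of_nonneg_right hC h2, mul_le_mul_of_nonneg_right hC h3, mul_le_mul_of_nonneg_right hC h4]

/-- The tame deep census is antitone in the tolerance: FINER registration tolerance is a WEAKER statement. [this file] -/
theorem tameBalancedDeepScaleGap_anti_tol {a s ρ ε₁ ε g : ℝ} (hε : ε₁ ≤ ε) (h : TameBalancedDeepScaleGap a s ρ ε g) :
    TameBalancedDeepScaleGap a s ρ ε₁ g :=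
  fun δ hδ hδ2 => balancedDeepScaleGapW_anti_tol hε (h δ hδ hδ2)

/-- The fine leaf at any depth `ρ₁ ≥ 4` and tolerance `ε₁ ≤ 3/50` is implied by the target of record. [this file] -/
theorem fine_of_target {ε₁ ρ₁ : ℝ} (hε : ε₁ ≤ 3 / 50) (hρ : 4 ≤ ρ₁)
    (h : TameBalancedDeepScaleGap (122 / 125) 0 4 (3 / 50) (1 / 450)) :
    TameBalancedDeepScaleGap (122 / 125) 0 ρ₁ ε₁ (1 / 450) :=
  tameBalancedDeepScaleGap_anti_tol hε (tameBalancedDeepScaleGap_mono hρ h)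

/-! ## §2  The MID census: sites deep at `(ρ, ε)` but not at `(ρ₁, ε₁)` -/

/-- Number of sites that are `(ρ, ε)`-deeply registered but NOT `(ρ₁, ε₁)`-deeply registered («mid-distortion» sites). -/
noncomputable def midCount (ρ ρ₁ ε₁ ε g : ℝ) (y : Fin N → EuclideanSpace ℝ (Fin 3)) : ℕ :=
  Nat.card {i : Fin N // DeepReg ρ ε g y i ∧ ¬ DeepReg ρ₁ ε₁ g y i}

/-- **`BalancedMidGapW ρ ρ₁ ε₁ ε g σ₁ σ₂` («MID_W»)** — the mid-distortion sites are priced IN AGGREGATE at `c > 0` each, against the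
same rebates as the balanced deep leaf: every not-`(ρ, ε)`-deep site, every off-window site, the surface, and the stress gain in one unit
direction.  No scale-badness enters: MID is a census of DISTORTION, not of scale. -/
def BalancedMidGapW (ρ ρ₁ ε₁ ε g σ₁ σ₂ : ℝ) : Prop :=
  ∃ c C : ℝ, 0 < c ∧ ∀ (N : ℕ) (y : Fin N → EuclideanSpace ℝ (Fin 3)), Function.Injective y →
    ∃ u : EuclideanSpace ℝ (Fin 3), ‖u‖ = 1 ∧
      (N : ℝ) * (⨅ Q : PeriodicConfiguration 3, Q.energyPerParticle lennardJones) + c * (midCount ρ ρ₁ ε₁ ε g y : ℝ)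
        - C * (notDeepCount ρ ε g y : ℝ) - C * (offCount σ₁ σ₂ y : ℝ) - C * (N : ℝ) ^ (2 / 3 : ℝ) - C * (dilGain y + shGain u y)
        ≤ interactionEnergy lennardJones y

/-- **`TameBalancedMidGap ρ ρ₁ ε₁ ε g` («MID»)** — `BalancedMidGapW ρ ρ₁ ε₁ ε g δ 2` for every window `[δ, 2]`, `0 < δ ≤ 2`. -/
def TameBalancedMidGap (ρ ρ₁ ε₁ ε g : ℝ) : Prop :=
  ∀ δ : ℝ, 0 < δ → δ ≤ 2 → BalancedMidGapW ρ ρ₁ ε₁ ε g δ 2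

/-- Counting: `#(scale-bad ∧ (ρ,ε)-deep) ≤ #(scale-bad ∧ (ρ₁,ε₁)-deep) + #MID`. [this file] -/
theorem regScaleCount_le_fine_add_mid {a s ρ ρ₁ ε₁ ε g : ℝ} (y : Fin N → EuclideanSpace ℝ (Fin 3)) :
    regScaleCount a s ρ ε g y ≤ regScaleCount a s ρ₁ ε₁ g y + midCount ρ ρ₁ ε₁ ε g y := by
  simp only [regScaleCount, midCount, Nat.card_eq_fintype_card, Fintype.card_subtype]
  calc (Finset.univ.filter fun i => (Bad a s y i ∧ (Short a s y i ∨ Long a s y i)) ∧ DeepReg ρ ε g y i).card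
      ≤ ((Finset.univ.filter fun i => (Bad a s y i ∧ (Short a s y i ∨ Long a s y i)) ∧ DeepReg ρ₁ ε₁ g y i) ∪
          (Finset.univ.filter fun i => DeepReg ρ ε g y i ∧ ¬ DeepReg ρ₁ ε₁ g y i)).card := by
        apply Finset.card_le_card
        intro i hi
        rw [Finset.mem_filter] at hi
        rw [Finset.mem_union, Finset.mem_filter, Finset.mem_filter]
        by_cases hD : DeepReg ρ₁ ε₁ g y i
        · exact Or.inl ⟨hi.1, hi.2.1, hD⟩
        · exact Or.inr ⟨hi.1, hi.2.2, hD⟩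
    _ ≤ _ := Finset.card_union_le _ _

/-- Counting: `#¬(ρ₁,ε₁)-deep ≤ #¬(ρ,ε)-deep + #MID`. [this file] -/
theorem notDeepCount_fine_le {ρ ρ₁ ε₁ ε g : ℝ} (y : Fin N → EuclideanSpace ℝ (Fin 3)) :
    notDeepCount ρ₁ ε₁ g y ≤ notDeepCount ρ ε g y + midCount ρ ρ₁ ε₁ ε g y := by
  simp only [notDeepCount, midCount, Nat.card_eq_fintype_card, Fintype.card_subtype]
  calc (Finset.univ.filter fun i => ¬ DeepReg ρ₁ ε₁ g y i).card
      ≤ ((Finset.univ.filter fun i => ¬ DeepReg ρ ε g y i) ∪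
          (Finset.univ.filter fun i => DeepReg ρ ε g y i ∧ ¬ DeepReg ρ₁ ε₁ g y i)).card := by
        apply Finset.card_le_card
        intro i hi
        rw [Finset.mem_filter] at hi
        rw [Finset.mem_union, Finset.mem_filter, Finset.mem_filter]
        by_cases hD : DeepReg ρ ε g y i
        · exact Or.inr ⟨hi.1, hD, hi.2⟩
        · exact Or.inl ⟨hi.1, hD⟩
    _ ≤ _ := Finset.card_union_le _ _

/-! ## §3  THE TOLERANCE SEAM (PROVED): fine leaf ∧ MID ⇒ leaf -/

/-- The real-arithmetic core of the seam: a convex combination of the two census inequalities. [this file] -/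
theorem convexComb_core {e E R₁ Rε M D₁ D O S G₁ G₂ G c₁ C₁ c₂ C₂ t m : ℝ}
    (h₁ : e + c₁ * R₁ - C₁ * D₁ - C₁ * O - C₁ * S - C₁ * G₁ ≤ E)
    (h₂ : e + c₂ * M - C₂ * D - C₂ * O - C₂ * S - C₂ * G₂ ≤ E)
    (hR : Rε ≤ R₁ + M) (hD : D₁ ≤ D + M)
    (hR₁ : 0 ≤ R₁) (hM : 0 ≤ M) (hD0 : 0 ≤ D) (hD₁ : 0 ≤ D₁) (hO : 0 ≤ O) (hS : 0 ≤ S)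
    (hG₁ : 0 ≤ G₁) (hG₂ : 0 ≤ G₂) (hG₁G : G₁ ≤ G) (hG₂G : G₂ ≤ G)
    (hc₂ : 0 < c₂) (ht0 : 0 < t) (ht4 : t ≤ 1 / 4) (htP : t * max C₁ 0 ≤ c₂ / 4)
    (hm0 : 0 ≤ m) (hm1 : m ≤ t * c₁) (hm2 : m ≤ c₂ / 4) :
    e + m * Rε - (max C₁ 0 + max C₂ 0) * D - (max C₁ 0 + max C₂ 0) * O - (max C₁ 0 + max C₂ 0) * S
      - (max C₁ 0 + max C₂ 0) * G ≤ E := by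
  set P₁ : ℝ := max C₁ 0 with hP₁
  set P₂ : ℝ := max C₂ 0 with hP₂
  have hP₁0 : 0 ≤ P₁ := le_max_right _ _
  have hP₂0 : 0 ≤ P₂ := le_max_right _ _
  have hC₁ : C₁ ≤ P₁ := le_max_left _ _
  have hC₂ : C₂ ≤ P₂ := le_max_left _ _
  have hG : 0 ≤ G := hG₁.trans hG₁G
  have ht1 : 0 ≤ 1 - t := by linarith
  -- upgrade the constants of the hypotheses to the nonnegative `P₁`, `P₂`
  have h₁' : e + c₁ * R₁ - P₁ * D₁ - P₁ * O - P₁ * S - P₁ * G₁ ≤ E := by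
    linarith [mul_nonneg (sub_nonneg.2 hC₁) hD₁, mul_nonneg (sub_nonneg.2 hC₁) hO, mul_nonneg (sub_nonneg.2 hC₁) hS,
      mul_nonneg (sub_nonneg.2 hC₁) hG₁]
  have h₂' : e + c₂ * M - P₂ * D - P₂ * O - P₂ * S - P₂ * G₂ ≤ E := by
    linarith [mul_nonneg (sub_nonneg.2 hC₂) hD0, mul_nonneg (sub_nonneg.2 hC₂) hO, mul_nonneg (sub_nonneg.2 hC₂) hS,
      mul_nonneg (sub_nonneg.2 hC₂) hG₂]
  have k₁ := mul_le_mul_of_nonneg_left h₁' ht0.le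
  have k₂ := mul_le_mul_of_nonneg_left h₂' ht1
  have p1 : m * Rε ≤ m * (R₁ + M) := mul_le_mul_of_nonneg_left hR hm0
  have p2 : m * R₁ ≤ t * c₁ * R₁ := mul_le_mul_of_nonneg_right hm1 hR₁
  have p3 : m * M ≤ c₂ / 4 * M := mul_le_mul_of_nonneg_right hm2 hM
  have p4 : t * P₁ * M ≤ c₂ / 4 * M := mul_le_mul_of_nonneg_right htP hM
  have p5 : 0 ≤ (1 / 4 - t) * c₂ * M := mul_nonneg (mul_nonneg (by linarith) hc₂.le) hM
  have p6 : t * P₁ * D₁ ≤ t * P₁ * (D + M) := mul_le_mul_of_nonneg_left hD (mul_nonneg ht0.le hP₁0)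
  have p7 : 0 ≤ (1 - t) * P₁ * D := mul_nonneg (mul_nonneg ht1 hP₁0) hD0
  have p8 : 0 ≤ t * P₂ * D := mul_nonneg (mul_nonneg ht0.le hP₂0) hD0
  have p9 : 0 ≤ (1 - t) * P₁ * O := mul_nonneg (mul_nonneg ht1 hP₁0) hO
  have p10 : 0 ≤ t * P₂ * O := mul_nonneg (mul_nonneg ht0.le hP₂0) hO
  have p11 : 0 ≤ (1 - t) * P₁ * S := mul_nonneg (mul_nonneg ht1 hP₁0) hS
  have p12 : 0 ≤ t * P₂ * S := mul_nonneg (mul_nonneg ht0.le hP₂0) hS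
  have p13 : t * P₁ * G₁ ≤ t * P₁ * G := mul_le_mul_of_nonneg_left hG₁G (mul_nonneg ht0.le hP₁0)
  have p14 : (1 - t) * P₂ * G₂ ≤ (1 - t) * P₂ * G := mul_le_mul_of_nonneg_left hG₂G (mul_nonneg ht1 hP₂0)
  have p15 : 0 ≤ (1 - t) * P₁ * G := mul_nonneg (mul_nonneg ht1 hP₁0) hG
  have p16 : 0 ≤ t * P₂ * G := mul_nonneg (mul_nonneg ht0.le hP₂0) hG
  have p0 : 0 ≤ c₂ * M := mul_nonneg hc₂.le hM
  linarith [k₁, k₂, p0, p1, p2, p3, p4, p5, p6, p7, p8, p9, p10, p11, p12, p13, p14, p15, p16]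

/-- **THE TOLERANCE SEAM at one window.  `BDSG_W a s ρ₁ ε₁ g σ₁ σ₂ → BalancedMidGapW ρ ρ₁ ε₁ ε g σ₁ σ₂ → BDSG_W a s ρ ε g σ₁ σ₂`**
(no hypothesis relating `(ρ, ε)` to `(ρ₁, ε₁)`).  Constants: `c = min (t c₁) (c₂/4)`, `C = C₁⁺ + C₂⁺`, `t = c₂ / (4 (C₁⁺ + c₂ + 1))`;
unit direction: the better of the two. [this file] -/
theorem balancedDeepScaleGapW_of_fine_mid {a s ρ ρ₁ ε₁ ε g σ₁ σ₂ : ℝ}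
    (hF : BalancedDeepScaleGapW a s ρ₁ ε₁ g σ₁ σ₂) (hMid : BalancedMidGapW ρ ρ₁ ε₁ ε g σ₁ σ₂) :
    BalancedDeepScaleGapW a s ρ ε g σ₁ σ₂ := by
  obtain ⟨c₁, C₁, hc₁, h₁⟩ := hF
  obtain ⟨c₂, C₂, hc₂, h₂⟩ := hMid
  have hP₁0 : 0 ≤ max C₁ 0 := le_max_right _ _
  have hK : 0 < max C₁ 0 + c₂ + 1 := by linarith
  set t : ℝ := c₂ / (4 * (max C₁ 0 + c₂ + 1)) with ht
  have ht0 : 0 < t := by rw [ht]; positivity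
  have ht4 : t ≤ 1 / 4 := by
    rw [ht, div_le_iff₀ (by positivity)]
    nlinarith
  have htP : t * max C₁ 0 ≤ c₂ / 4 := by
    rw [ht, div_mul_eq_mul_div, div_le_iff₀ (by positivity)]
    nlinarith [mul_nonneg hc₂.le hP₁0, mul_nonneg hc₂.le hc₂.le]
  set m : ℝ := min (t * c₁) (c₂ / 4) with hm
  have hm0 : 0 < m := lt_min (mul_pos ht0 hc₁) (by positivity)
  refine ⟨m, max C₁ 0 + max C₂ 0, hm0, fun N y hy => ?_⟩
  obtain ⟨u₁, hu₁, H₁⟩ := h₁ N y hy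
  obtain ⟨u₂, hu₂, H₂⟩ := h₂ N y hy
  have hRc : (regScaleCount a s ρ ε g y : ℝ) ≤ regScaleCount a s ρ₁ ε₁ g y + midCount ρ ρ₁ ε₁ ε g y := by
    exact_mod_cast regScaleCount_le_fine_add_mid y
  have hDc : (notDeepCount ρ₁ ε₁ g y : ℝ) ≤ notDeepCount ρ ε g y + midCount ρ ρ₁ ε₁ ε g y := by
    exact_mod_cast notDeepCount_fine_le y
  have n1 : (0 : ℝ) ≤ regScaleCount a s ρ₁ ε₁ g y := Nat.cast_nonneg _
  have n2 : (0 : ℝ) ≤ midCount ρ ρ₁ ε₁ ε g y := Nat.cast_nonneg _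
  have n3 : (0 : ℝ) ≤ notDeepCount ρ ε g y := Nat.cast_nonneg _
  have n4 : (0 : ℝ) ≤ notDeepCount ρ₁ ε₁ g y := Nat.cast_nonneg _
  have n5 : (0 : ℝ) ≤ offCount σ₁ σ₂ y := Nat.cast_nonneg _
  have n6 : (0 : ℝ) ≤ (N : ℝ) ^ (2 / 3 : ℝ) := Real.rpow_nonneg (Nat.cast_nonneg _) _
  have g1 : 0 ≤ dilGain y + shGain u₁ y := add_nonneg (dilGain_nonneg y) (shGain_nonneg _ y)
  have g2 : 0 ≤ dilGain y + shGain u₂ y := add_nonneg (dilGain_nonneg y) (shGain_nonneg _ y)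
  rcases le_total (shGain u₁ y) (shGain u₂ y) with hle | hle
  · refine ⟨u₂, hu₂, ?_⟩
    exact convexComb_core H₁ H₂ hRc hDc n1 n2 n3 n4 n5 n6 g1 g2 (by linarith) le_rfl hc₂ ht0 ht4 htP hm0.le
      (min_le_left _ _) (min_le_right _ _)
  · refine ⟨u₁, hu₁, ?_⟩
    exact convexComb_core H₁ H₂ hRc hDc n1 n2 n3 n4 n5 n6 g1 g2 le_rfl (by linarith) hc₂ ht0 ht4 htP hm0.le
      (min_le_left _ _) (min_le_right _ _)

/-- **THE TOLERANCE SEAM (tame form).  `TameBalancedDeepScaleGap a s ρ₁ ε₁ g → TameBalancedMidGap ρ ρ₁ ε₁ ε g →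
TameBalancedDeepScaleGap a s ρ ε g`.** [this file] -/
theorem tameBalancedDeepScaleGap_of_fine_mid {a s ρ ρ₁ ε₁ ε g : ℝ} (hF : TameBalancedDeepScaleGap a s ρ₁ ε₁ g)
    (hMid : TameBalancedMidGap ρ ρ₁ ε₁ ε g) : TameBalancedDeepScaleGap a s ρ ε g :=
  fun δ hδ hδ2 => balancedDeepScaleGapW_of_fine_mid (hF δ hδ hδ2) (hMid δ hδ hδ2)

/-- The seam ITERATES (tolerance ladder `ε₁, ε₂, ε`; depths `ρ₁, ρ₂, ρ`). [this file] -/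
theorem tameBalancedDeepScaleGap_of_fine_mid_mid {a s ρ ρ₂ ρ₁ ε₁ ε₂ ε g : ℝ}
    (hF : TameBalancedDeepScaleGap a s ρ₁ ε₁ g) (hM₁ : TameBalancedMidGap ρ₂ ρ₁ ε₁ ε₂ g)
    (hM₂ : TameBalancedMidGap ρ ρ₂ ε₂ ε g) : TameBalancedDeepScaleGap a s ρ ε g :=
  tameBalancedDeepScaleGap_of_fine_mid (tameBalancedDeepScaleGap_of_fine_mid hF hM₁) hM₂

end Summit.AtomisticToContinuum.Crystallization.Theorems.OverbindingBudgetHarmonicNormalForm
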